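import Summits.QuantumFields.YangMills.Theorems.AlphaInputsT3ACHistories
import Summits.QuantumFields.YangMills.Theorems.AlphaInputsT3ACEnvelope
import Summits.QuantumFields.YangMills.Theorems.UV3PartitionLowerOfWindow
import Summits.QuantumFields.YangMills.Theorems.UV3PinnedRatioOfTowerBounds
import Literature.MathematicalPhysics.QuantumFieldTheory.Balaban1983to89.B10Eq5RegularAction
import Literature.MathematicalPhysics.QuantumFieldTheory.Balaban1983to89.B10Eq41TorusHistories
import HarnessLib

/-!
# S-low″ — THE (47)-HALF OF THE UNIT ENVELOPE, K-UNIFORM, MODULO THE T3 (α) PACKAGE: `exp(−E_K − Cl) ≤ Z_K` WITH PRINT's OWN VACUUM-ENERGY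
# CONSTANT `E_K = (dataT3).Ecst K K` AS THE ANCHOR

Cell `ym3-torus` (YM ladder rung R3 = continuum `SU(2)` Yang–Mills on the three-torus — a RUNG, NOT d = 4, NOT infinite volume, NOT a mass gap,
NOT Clay).  Width seat `ym3-torus-px12` (gen 12; p1-lineage purpose = the UV3 node of [Balaban1985UV3]); `--supports stmt-QuantumFields-19936 --as helper`,
count-neutral, definition-free, default heartbeats.  ★★OWNER WORD 51 (2) ∕ hand (a) «px12: S-low″»; LOCATE `LOCATE-SLOW-V2-ANCHOR-px12g12.md` (19936 evidence #52).

THE POINT.  The (α′) line «pinned (41)» for `UnitScaleTilt.HistoryTailL` needs, besides the pinned upper bound (S-step), a LOWER bound on the partition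
function `Z_K = ∫ρ_K` that shares S-step's normalisation.  Print's shared normalisation is the vacuum-energy constant `E_K` of (41)∕(47) ((64) p.273) — a
NUMBER, carried as data by the tree's T3 (α) socket (`T3AlphaInputsAC.AlphaDataT3.Ecst`), hence version-independent (★★OWNER RULING №32 (1)).  For the
datum ASSEMBLED from the package `AlphaInputsT3AC.Of F 𝔠` (`AlphaInputsT3AC.Of.dataT3`, lane pub-balaban3d ∕ seat alpha-1) the tree already proves, at the
TOP level `j = K` of every run: (47) `dV`-a.e. (`dataT3_ineq47AE`: `e^{−E_K − Rm_K}·low_K ≤ ρ_K`, `low = χ·e^{−mainT(triv) + Pint(triv)}`), `χ_K = 1` on the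
window `{PlaqSmall θBal(0)}` (`dataT3_chi_eq_one_of_plaqSmall`), the remainder size (`dataT3_exp_two_Rm_le`, `dataT3_rmSize`), `mainT = β_K·A(U_min)`
(`dataT3_mainTermIsAction`), `θBal > 0` (`PkgAt.θBal_pos`).  THIS FILE integrates that over the window with the K-UNIFORM window volume of ✓p744493
(`UV3PartitionLowerOfWindow.exp_le_integral_emlDensity_top_of_plaqSmall_floor_ae`):
* ★★ `exp_Ecst_le_partitionFn_of_package` — under the package and TWO displayed top-level window rows (a K-uniform bound `Cm` on the trivial-history
  main term `mainT_K(triv, W)` and a K-uniform lower bound `−CP` on `Pint_K(triv, W)`, both on `{PlaqSmall θBal(0)}` of `T₁^{(K)}`):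
  `∃ Cl, ∀ K, exp(−Ecst K K − Cl) ≤ ∫ ρ_K dV_K` — S-low″ = the `hLOW` slot of px13's Z-DOOR ✓p743895 with `E := Ecst K K`, K-uniform `Cl`.
* ★ `mainT_top_le_of_actionBound` — the main-term row from a K-uniform bound on `β_K·A(U_min(triv, W))` (`dataT3_mainTermIsAction`).
* ★ `beta_mul_wilsonAction4_le_of_regFibrePr` — that bound for ANY configuration in print's regular fibre `regFibrePr F 0 K ε₀ V` over the unit lattice:
  `β_K·A(U) ≤ 12·ε₀²·L^{3m}∕γ`, INDEPENDENT OF `K` ((11) p.258 `1 − Re tr ≤ ½|·−1|²` on `24L^{3(m+K)}` fine plaquettes of size `ε₀L^{−2K}`; port of the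
  Cruxes workfile lemma `monotone_depth_dini.beta_mul_minActionRegPr_le` at `J = 0`, made membership-explicit) — so the main-term row is ONE membership row
  «`U_min(triv, W) ∈ regFibrePr F 0 K ε₀ V`» = [Balaban1985Variational] Thm 1 (8) = the EX lane's content (19200), not a new organ.
* ★ `unitEnvelope_of_halves` — the ideator's KNIT (bus 2026-08-29 21:24:12Z): for any anchor sequence `E : ℕ → ℝ`, an a.e. UPPER half
  `ρ_K ≤ e^{−E_K + Cu'}` and a LOWER half `e^{−E_K − Cl} ≤ ∫ρ_K` give the registered `stub_unitEnvelope`'s letter per `(F, γ)`: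
  `∃ Cl', ∀ K, ∀ᵐ V, ρ_K V ≤ e^{Cl'}·Z_K` (`Cl' := Cu' + Cl`, (6) `∫ρ_K = Z_K`) — so R-19936-U = (U″) [the resummation organ at the trivial pin] + (L″) [this file]
  + this knit, as ★★OWNER RECORD 17aq books it.

HONEST SCOPE.  Bookkeeping over the package's landed rows and ✓p744493; CONDITIONAL on `AlphaInputsT3AC.Of F 𝔠` (the UV3 node's (α) inputs, hypothesis schema)
and on the two displayed window rows; nothing of (41)'s pinned form (S-step), of Theorem 1's upper bound, of `stub_pinnedRatio`∕`hP`, of `HistoryTailL` (19936) or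
of the rung is proved here.  Sorry-free, axioms standard.

References: T. Bałaban, *Ultraviolet stability of three-dimensional lattice pure gauge field theories*, Commun. Math. Phys. **102** (1985) 255–275
[Balaban1985UV3] ((4)–(6) pp.256–257, (11) p.258, (41) p.266, (47) p.267, (64) p.273); T. Bałaban, *Averaging operations for lattice gauge theories*,
Commun. Math. Phys. **102** (1985) 277–309 [Balaban1985Variational] (Thm 1 (6)–(8) pp.278–279).
-/

set_option autoImplicit false

noncomputable section

namespace Summit.QuantumFields.YangMills.Theorems.UV3UnitPartitionLowerOfPackage

open MeasureTheory
open Literature.MathematicalPhysics.QuantumFieldTheory.Balaban1983to89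
open Literature.MathematicalPhysics.QuantumFieldTheory.Balaban1983to89.T3ContinuumYM3Torus
open Literature.MathematicalPhysics.QuantumFieldTheory.Balaban1983to89.T3UnitLawDensityEML (ℰp emlDensity)
open Literature.MathematicalPhysics.QuantumFieldTheory.Balaban1983to89.T3UnitScaleTilt (θBal)
open Literature.MathematicalPhysics.QuantumFieldTheory.Balaban1983to89.T3RestrictedUnitDensity (resDensity towerDensity emlDensity_eq_towerDensity)
open Literature.MathematicalPhysics.QuantumFieldTheory.Balaban1983to89.T3PrintedRegularMinimiser (RegPr regFibrePr mem_regFibrePr_iff)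
open Literature.MathematicalPhysics.QuantumFieldTheory.Balaban1983to89.T3RegularMinimiser (regThreshold)
open Literature.MathematicalPhysics.QuantumFieldTheory.Balaban1983to89.T3AlphaInputsAC
open Literature.MathematicalPhysics.QuantumFieldTheory.Balaban1985CMP102
open Literature.MathematicalPhysics.QuantumFieldTheory.Balaban1985CMP102.Setting
open Summit.QuantumFields.Balaban3D.Carriers
open Summit.QuantumFields.Balaban3D.Proofs.Primitives
open Summit.QuantumFields.YangMills.Theorems.UV3PartitionLowerOfWindow (exp_le_integral_emlDensity_top_of_plaqSmall_floor_ae)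

/-! ## §1 The restricted density at `S = univ` is the renormalised density -/

/-- `resDensity F γ K univ k = ρ_k` (`𝟙_univ·e^{−β_K A} = e^{−β_K A}` and `towerDensity` of it is `emlDensity`, lit `emlDensity_eq_towerDensity`).
[cite: Balaban1985UV3, (1)–(2) p.256] -/
theorem resDensity_univ_eq (F : T3Family) (γ : ℝ) (K k : ℕ) :
    resDensity F γ K Set.univ k = emlDensity F γ K k := by
  unfold resDensity
  rw [Set.indicator_univ, emlDensity_eq_towerDensity]

/-! ## §2 S-low″: the (47)-half of the unit envelope, K-uniform, modulo the package -/

variable {F : T3Family} {𝔠 : AlphaConsts F.L (suGroupModel 2).N}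

/-- ★★ **S-low″ — `exp(−E_K − Cl) ≤ Z_K` FOR EVERY RUN `K`, ONE `Cl` (after `F, γ`), MODULO THE (α) PACKAGE AND TWO TOP-LEVEL WINDOW ROWS.**  Under
`AlphaInputsT3AC.Of F 𝔠` at `γ ∈ (0, (min γ₀ 1)²]`, let `D := h.dataT3 γ hγ hγ1 π`.  IF on the small-field window `{PlaqSmall θBal(0)}` of the unit lattice
`T₁^{(K)}` the trivial-history main term is bounded (`mainT_K(triv, W) ≤ Cm`) and the trivial-history interaction sum is bounded below (`−CP ≤ Pint_K(triv, W)`),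
K-uniformly, THEN `∃ Cl, ∀ K, exp(−D.Ecst K K − Cl) ≤ ∫ ρ_K dV_K` — (47)_K ((`dataT3_ineq47AE`, a.e.) × `χ_K = 1` on the window (`dataT3_chi_eq_one_of_plaqSmall`)
× the remainder size (`dataT3_exp_two_Rm_le`) integrated over the window with the K-uniform product-Haar volume (✓`exp_le_integral_emlDensity_top_of_plaqSmall_floor_ae`).
This is the `hLOW` slot of the Z-DOOR ✓`UV3PinnedRatioOfTowerBounds` with `E := D.Ecst K K`. [cite: Balaban1985UV3, (47) p.267, (5)–(6) pp.256–257, (64) p.273] -/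
theorem exp_Ecst_le_partitionFn_of_package (h : AlphaInputsT3AC.Of F 𝔠) (γ : ℝ) (hγ : 0 < γ) (hγ1 : γ ≤ (min 𝔠.gamma0 1) ^ 2)
    (π : AlphaInputsT3AC.PolymerT3 F)
    (hMain : ∃ Cm : ℝ, ∀ (K : ℕ) (W : GaugeField (F.P K) K (Matrix.specialUnitaryGroup (Fin 2) ℂ)),
      PlaqSmall (θBal F.L γ 𝔠.b₀ 𝔠.p₀ 0) W →
        (h.dataT3 γ hγ hγ1 π).mainT K K ((h.dataT3 γ hγ hγ1 π).triv K K) W ≤ Cm)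
    (hPint : ∃ CP : ℝ, ∀ (K : ℕ) (W : GaugeField (F.P K) K (Matrix.specialUnitaryGroup (Fin 2) ℂ)),
      PlaqSmall (θBal F.L γ 𝔠.b₀ 𝔠.p₀ 0) W →
        -CP ≤ (h.dataT3 γ hγ hγ1 π).Pint K K ((h.dataT3 γ hγ hγ1 π).triv K K) W) :
    ∃ Cl : ℝ, ∀ K : ℕ,
      Real.exp (-((h.dataT3 γ hγ hγ1 π).Ecst K K) - Cl) ≤
        ∫ V, emlDensity F γ K K V ∂fieldMeasure (F.P K) K (Matrix.specialUnitaryGroup (Fin 2) ℂ) := by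
  obtain ⟨Cm, hCm⟩ := hMain
  obtain ⟨CP, hCP⟩ := hPint
  obtain ⟨CRm, hCRm⟩ := h.dataT3_exp_two_Rm_le γ hγ hγ1 π
  have hθ : 0 < θBal F.L γ 𝔠.b₀ 𝔠.p₀ 0 := by
    have := (h.pkgAt γ hγ hγ1 0).θBal_pos 0 le_rfl
    simpa using this
  obtain ⟨Cv, hCv⟩ := exp_le_integral_emlDensity_top_of_plaqSmall_floor_ae F hγ.le hθ
  -- `CRm > 0` (it dominates an exponential), so `log CRm` makes sense and `Rm_K ≤ log CRm`
  have hCRm0 : 0 < CRm := (Real.exp_pos _).trans_le (hCRm 0 0 le_rfl)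
  refine ⟨Real.log CRm + Cm + CP + Cv, fun K => ?_⟩
  set D := h.dataT3 γ hγ hγ1 π with hD
  -- the a.e. floor on the window: (47)_K with χ_K = 1, Rm_K ≤ log CRm, mainT ≤ Cm, Pint ≥ −CP
  have h47 : Ineq47AE D K K := h.dataT3_ineq47AE γ hγ hγ1 π K K le_rfl
  have hRm0 : 0 ≤ D.Rm K K := Rm_nonneg (h.dataT3_rmSize γ hγ hγ1 π) le_rfl
  have hRm : D.Rm K K ≤ Real.log CRm := by
    have h2 : Real.exp (2 * D.Rm K K) ≤ CRm := hCRm K K le_rfl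
    have h1 : Real.exp (D.Rm K K) ≤ Real.exp (2 * D.Rm K K) := Real.exp_le_exp.mpr (by linarith)
    exact (Real.le_log_iff_exp_le hCRm0).mpr (h1.trans h2)
  have hfloor : ∀ᵐ W ∂fieldMeasure (F.P K) K (Matrix.specialUnitaryGroup (Fin 2) ℂ),
      PlaqSmall (θBal F.L γ 𝔠.b₀ 𝔠.p₀ 0) W →
        Real.exp (-(D.Ecst K K + Real.log CRm + Cm + CP)) ≤ emlDensity F γ K K W := by
    filter_upwards [h47] with W hW hsmall
    have hχ : D.χ K K W = 1 := by
      have := h.dataT3_chi_eq_one_of_plaqSmall γ hγ hγ1 π K K le_rfl W (by simpa using hsmall)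
      simpa [hD] using this
    have hlow : D.low K K W = Real.exp (-(D.mainT K K (D.triv K K) W) + D.Pint K K (D.triv K K) W) := by
      unfold AlphaDataT3.low
      rw [hχ, one_mul]
    have hm := hCm K W hsmall
    have hp := hCP K W hsmall
    rw [← resDensity_univ_eq F γ K K]
    refine le_trans ?_ hW
    rw [hlow, ← Real.exp_add]
    exact Real.exp_le_exp.mpr (by linarith)
  have hint := hCv K (D.Ecst K K + Real.log CRm + Cm + CP) hfloor
  have e : -(D.Ecst K K) - (Real.log CRm + Cm + CP + Cv) = -(D.Ecst K K + Real.log CRm + Cm + CP + Cv) := by ring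
  rw [e]
  exact hint

/-! ## §3 The main-term row from a bound on the action of the trivial-history minimiser, and that bound on print's regular fibre -/

/-- ★ **THE MAIN-TERM ROW FROM AN ACTION BOUND**: `mainT_K(triv, W) = β_K·A(U_min(triv, W))` for the assembled datum (`dataT3_mainTermIsAction`), so a
K-uniform bound on `β_K·A(U_min(triv, W))` on the window is the row `hMain` of `exp_Ecst_le_partitionFn_of_package`. [cite: Balaban1985UV3, (41)–(42) p.266, (5) p.256] -/
theorem mainT_top_le_of_actionBound (h : AlphaInputsT3AC.Of F 𝔠) (γ : ℝ) (hγ : 0 < γ) (hγ1 : γ ≤ (min 𝔠.gamma0 1) ^ 2)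
    (π : AlphaInputsT3AC.PolymerT3 F) {Cm : ℝ}
    (hA : ∀ (K : ℕ) (W : GaugeField (F.P K) K (Matrix.specialUnitaryGroup (Fin 2) ℂ)),
      PlaqSmall (θBal F.L γ 𝔠.b₀ 𝔠.p₀ 0) W →
        (F.scheme ℰp γ).β K * wilsonAction4 ((h.dataT3 γ hγ hγ1 π).Umin K K ((h.dataT3 γ hγ hγ1 π).triv K K) W) ≤ Cm) :
    ∀ (K : ℕ) (W : GaugeField (F.P K) K (Matrix.specialUnitaryGroup (Fin 2) ℂ)),
      PlaqSmall (θBal F.L γ 𝔠.b₀ 𝔠.p₀ 0) W →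
        (h.dataT3 γ hγ hγ1 π).mainT K K ((h.dataT3 γ hγ hγ1 π).triv K K) W ≤ Cm := by
  intro K W hW
  rw [h.dataT3_mainTermIsAction γ hγ hγ1 π K K ((h.dataT3 γ hγ hγ1 π).triv K K) W]
  exact hA K W hW

/-- ★ **`β_K·A(U) ≤ 12·ε₀²·L^{3m}∕γ` FOR EVERY `U` IN PRINT's REGULAR FIBRE OVER THE UNIT LATTICE**, INDEPENDENT OF THE RUN `K`: every plaquette of a
printed-regular `U` (comparison lattice = the unit lattice, `n = 0`) is within `ε₀L^{−2K}` of `1`, so by (11) `1 − Re tr ≤ ½|· − 1|²` the Wilson action is at most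
`#Plaq·½ε₀²L^{−4K}` with `#Plaq = 24·L^{3(m+K)}`, and `β_K = L^K∕γ` — the powers of `L^K` cancel (port of the Cruxes workfile lemma
`FluctuationComparisonRegPrIntL/Lines/monotone_depth_dini.beta_mul_minActionRegPr_le` at `J = 0`, membership-explicit).  With the membership row
«`U_min(triv, W) ∈ regFibrePr F 0 K _ ε₀ V`» ([Balaban1985Variational] Thm 1 (8), the EX lane) this discharges `hA` of `mainT_top_le_of_actionBound`.
[cite: Balaban1985UV3, (11) p.258, (5) p.256; Balaban1985Variational, Thm 1 (6)–(8) pp.278–279] -/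
theorem beta_mul_wilsonAction4_le_of_regFibrePr (F : T3Family) {γ : ℝ} (hγ : 0 < γ) (ε₀ : ℝ) (K : ℕ)
    (V : GaugeField (F.P 0) 0 (Matrix.specialUnitaryGroup (Fin 2) ℂ))
    {U : GaugeField (F.P K) 0 (Matrix.specialUnitaryGroup (Fin 2) ℂ)} (hU : U ∈ regFibrePr F 0 K (Nat.zero_le K) ε₀ V) :
    (F.scheme ℰp γ).β K * wilsonAction4 U ≤ 12 * ε₀ ^ 2 * (F.L : ℝ) ^ (3 * F.m) / γ := by
  have hL : (1 : ℝ) < F.L := by exact_mod_cast F.hL.2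
  have hL0 : (0 : ℝ) < F.L := zero_lt_one.trans hL
  have hβ : (F.scheme ℰp γ).β K = (γ * ((F.L : ℝ)⁻¹) ^ K)⁻¹ := rfl
  have hβ0 : 0 ≤ (F.scheme ℰp γ).β K := F.scheme_β_nonneg ℰp hγ.le _
  have hsite : Fintype.card (Site (F.P K) 0) = (2 * F.L ^ (F.m + K)) ^ 3 := by
    rw [show Fintype.card (Site (F.P K) 0) = Fintype.card (Fin 3 → ZMod ((F.P K).sitesPerDir 0)) from
      Fintype.card_congr (Equiv.refl _)]
    rw [Fintype.card_fun, ZMod.card, Fintype.card_fin]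
    simp [Params.sitesPerDir]
  have hplaq : (Fintype.card (Plaq (F.P K) 0) : ℝ) = 24 * (F.L : ℝ) ^ (3 * F.m + 3 * K) := by
    rw [B10Eq41TorusHistories.card_plaq_three (F.P_d K) 0, hsite]
    push_cast
    ring
  have hreg : PlaqSmall (regThreshold F 0 K ε₀) U := ((mem_regFibrePr_iff F).mp hU).2.plaqSmall
  have ht : regThreshold F 0 K ε₀ = ε₀ * ((F.L : ℝ)⁻¹) ^ (2 * K) := by
    show ε₀ * ((F.L : ℝ)⁻¹) ^ (2 * (K - 0)) = _
    rw [Nat.sub_zero]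
  have hA : wilsonAction4 U ≤ (Fintype.card (Plaq (F.P K) 0) : ℝ) * ((1 / 2) * (ε₀ * ((F.L : ℝ)⁻¹) ^ (2 * K)) ^ 2) := by
    unfold wilsonAction4 wilsonAction
    calc ∑ p : Plaq (F.P K) 0, (1 : ℝ) * (1 - reTr (GaugeField.plaqHol U p))
        ≤ ∑ _p : Plaq (F.P K) 0, (1 / 2) * (ε₀ * ((F.L : ℝ)⁻¹) ^ (2 * K)) ^ 2 := by
          refine Finset.sum_le_sum fun p _ => ?_
          rw [one_mul]
          have h1 := B10Eq5RegularAction.one_sub_reTr_le_specialUnitaryGroup (GaugeField.plaqHol U p)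
          have h2 : dist1 (GaugeField.plaqHol U p) < ε₀ * ((F.L : ℝ)⁻¹) ^ (2 * K) := ht ▸ hreg p
          have h3 : 0 ≤ dist1 (GaugeField.plaqHol U p) := GaugeGroup.dist1_nonneg _
          nlinarith [h1, h2, h3, sq_nonneg (dist1 (GaugeField.plaqHol U p)), mul_self_le_mul_self h3 h2.le]
      _ = (Fintype.card (Plaq (F.P K) 0) : ℝ) * ((1 / 2) * (ε₀ * ((F.L : ℝ)⁻¹) ^ (2 * K)) ^ 2) := by
          rw [Finset.sum_const, Finset.card_univ, nsmul_eq_mul]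
  calc (F.scheme ℰp γ).β K * wilsonAction4 U
      ≤ (F.scheme ℰp γ).β K * ((Fintype.card (Plaq (F.P K) 0) : ℝ) * ((1 / 2) * (ε₀ * ((F.L : ℝ)⁻¹) ^ (2 * K)) ^ 2)) :=
        mul_le_mul_of_nonneg_left hA hβ0
    _ = 12 * ε₀ ^ 2 * (F.L : ℝ) ^ (3 * F.m) / γ := by
        rw [hβ, hplaq]
        have hLK : ((F.L : ℝ)⁻¹) ^ (2 * K) = ((F.L : ℝ) ^ (2 * K))⁻¹ := by rw [inv_pow]
        rw [hLK, inv_pow]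
        field_simp
        ring

/-! ## §4 The knit: the two halves give the registered unit envelope -/

/-- ★ **HALVES ⟹ ENVELOPE** (the ideator's knit, ★★OWNER RECORD 17aq accounting): for ANY anchor sequence `E : ℕ → ℝ`, an a.e. upper half
`ρ_K ≤ exp(−E_K + Cu')` (K-uniform `Cu'`) and a lower half `exp(−E_K − Cl) ≤ ∫ρ_K dV_K` (K-uniform `Cl`) give `∀ᵐ V, ρ_K V ≤ exp(Cu' + Cl)·Z_K` for every `K`
— the letter of `stub_unitEnvelope` per `(F, γ)`, `Z_K = ∫ρ_K` by (6) (✓`UV3PinnedRatioOfTowerBounds.integral_emlDensity_eq_partitionFn`); the anchor cancels.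
[cite: Balaban1985UV3, (5) p.256, (6) p.257] -/
theorem unitEnvelope_of_halves (F : T3Family) {γ : ℝ} (hγ : 0 ≤ γ) (E : ℕ → ℝ)
    (hU : ∃ Cu' : ℝ, ∀ K : ℕ, ∀ᵐ V ∂fieldMeasure (F.P K) K (Matrix.specialUnitaryGroup (Fin 2) ℂ),
      emlDensity F γ K K V ≤ Real.exp (-E K + Cu'))
    (hL : ∃ Cl : ℝ, ∀ K : ℕ,
      Real.exp (-E K - Cl) ≤ ∫ V, emlDensity F γ K K V ∂fieldMeasure (F.P K) K (Matrix.specialUnitaryGroup (Fin 2) ℂ)) :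
    ∃ Cl' : ℝ, ∀ K : ℕ, ∀ᵐ V ∂fieldMeasure (F.P K) K (Matrix.specialUnitaryGroup (Fin 2) ℂ),
      emlDensity F γ K K V ≤
        Real.exp Cl' * Missing.partitionFn (G := Matrix.specialUnitaryGroup (Fin 2) ℂ) (F.P K) ((F.scheme ℰp γ).β K) := by
  obtain ⟨Cu', hCu⟩ := hU
  obtain ⟨Cl, hCl⟩ := hL
  refine ⟨Cu' + Cl, fun K => ?_⟩
  have hZ : Real.exp (-E K - Cl) ≤
      Missing.partitionFn (G := Matrix.specialUnitaryGroup (Fin 2) ℂ) (F.P K) ((F.scheme ℰp γ).β K) := by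
    rw [← UV3PinnedRatioOfTowerBounds.integral_emlDensity_eq_partitionFn F K hγ K (Nat.le_add_left K F.m)]
    exact hCl K
  filter_upwards [hCu K] with V hV
  calc emlDensity F γ K K V ≤ Real.exp (-E K + Cu') := hV
    _ = Real.exp (Cu' + Cl) * Real.exp (-E K - Cl) := by rw [← Real.exp_add]; ring_nf
    _ ≤ Real.exp (Cu' + Cl) * Missing.partitionFn (G := Matrix.specialUnitaryGroup (Fin 2) ℂ) (F.P K) ((F.scheme ℰp γ).β K) :=
        mul_le_mul_of_nonneg_left hZ (Real.exp_pos _).le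

end Summit.QuantumFields.YangMills.Theorems.UV3UnitPartitionLowerOfPackage

end
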